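import Literature.NumberTheory.EllipticCurves.SerreOpenImageSupersingularInertiaProofs
import Literature.NumberTheory.EllipticCurves.SerreOpenImageTameKummerProofs
import HarnessLib

/-!
# Serre 1972, §1.11, Prop. 12 d) over `ℚ`, local half: at a good supersingular prime the
# Frobenius does NOT act on `E[ℓ]` through the inertia image — `ρ̄(D_𝔓) ≠ ρ̄(I_𝔓)`

Topic `NumberTheory/EllipticCurves`.  Theorems only (nothing is defined, no named fact).  Sequel of
`SerreOpenImageSupersingularInertiaProofs` (Prop. 12 c): the image of the inertia group `I = I_𝔓`
on `E[ℓ]` is cyclic of order `ℓ² - 1`, a non-split Cartan subgroup `C`).  J.-P. Serre, Invent.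
Math. 15 (1972), §1.11, Prop. 12, p. 275 (`e = 1`, good reduction of height `2`; `G` = the local
Galois group = the decomposition group, `k` its residue field): *"c) L'image de `I` dans `GL(E_p)`
est un groupe cyclique `C` d'ordre `p² - 1` («sous-groupe de Cartan non déployé»). d) L'image de
`G` dans `GL(E_p)` est égale à `C` ou au normalisateur `N` de `C` suivant que `k` contient ou ne
contient pas `F_{p²}`"* — over `ℚ_ℓ` (`k = F_ℓ`) it is `N`, in particular NOT `C`: a Frobenius
`φ ∈ D_𝔓` conjugates the tame character `θ_{ℓ²-1}` into its `ℓ`-th power (`θ(φ s φ⁻¹) = θ(s)^ℓ`: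
§1.3 Prop. 1 defines `θ_d` by `s(x^{1/d}) = θ_d(s) x^{1/d}`, and §1.8 Prop. 6 / §1.9 Prop. 9 (i)
record that `s ∈ G` acts `σ`-semilinearly, `σ` = the image of `s` in `Gal(k̄/k)`), and `θ^ℓ ≠ θ`
on a cyclic group of order `ℓ² - 1 ∤ ℓ - 1`, so `ρ̄(φ)` does not centralise `ρ̄(I) = C` and hence
`ρ̄(φ) ∉ C` (`C` is abelian).  (Items a), b) of Prop. 12 — `I_p` acts trivially; `E_p` carries an
`F_{p²}`-line structure on which `I_t` acts through the fundamental character `θ_{p²-1}` of level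
`2` — are what the prequel's proof of c) runs on (the tame character `θ` of `I` read off the
parameters `t = x/y`); §1.9 Prop. 9 Cor. 2 (p. 270) is the statement "`k = F_p` ⇒ the image of `G`
is the normaliser of the Cartan subgroup `F_q^*`".)

This file proves exactly that consequence, for `E = W/ℚ` in global minimal form, `ℓ` an odd prime
of good supersingular reduction (`ℓ ∤ Δ_min`, `ℓ ∣ a_ℓ`), the prime `𝔓` of `\bar ℤ` cut out by the
place `placeOver ℓ` and an arithmetic Frobenius `φ` at `𝔓` (`IsArithFrobAt`, the tree's
`HeightOneSpectrum.exists_isArithFrobAt_of_mem_primesAbove_holds`):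

* `smul_eq_of_pow_eq_one_of_mem_inertia` — inertia fixes the roots of unity of order prime to `ℓ`;
* `conj_frob_smul_kummer` — **`(φ s φ⁻¹) π = ζ^ℓ π` when `s π = ζ π`** (`π^{ℓ²-1} = ℓ`): conjugation
  by Frobenius is the `ℓ`-th power on the tame Kummer character;
* `smul_kummer_eq_of_galoisRepTorsion_eq_one` — **an element of `I_𝔓` acting trivially on `E[ℓ]`
  acts trivially on `π`** (the parameter `t₀ = x₀/y₀` of a point of `E[ℓ]` has the valuation of
  `π`, Prop. 9–10 = the tree's `valuation_param_pow_eq`, and inertia is trivial on unit residues);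
* `galoisRepTorsion_not_mem_map_inertia_of_isArithFrobAt` — **MAIN: `ρ̄_{E,ℓ}(φ) ∉ ρ̄_{E,ℓ}(I_𝔓)`**;
* `exists_mem_stabilizer_galoisRepTorsion_not_mem_map_inertia` — packaged with the existence of
  `𝔓` and `φ`: above the place of `ℚ` at `ℓ` there are a prime `𝔓` of `\bar ℤ` and `φ ∈ D_𝔓` with
  `ρ̄(φ) ∉ ρ̄(I_𝔓)`, while `ρ̄(I_𝔓)` is cyclic of order `ℓ² - 1` (so `ρ̄(D_𝔓)` has order `> ℓ² - 1`:
  the residue degree of `ℚ(E[ℓ])` at `ℓ` is `2`, its ramification index `ℓ² - 1`).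

Consumer: cell bsd-print-x8 (ty2 discharge interface), `Summits/…/Supersingular/X8PrintDischargeOnePrime`:
on the small-image leaf (`ρ̄(Γ_ℚ) = N`, order `2(ℓ² - 1)`) this forces `ρ̄(D_𝔓) = ρ̄(Γ_ℚ)`, i.e.
`ℚ(E[ℓ])` has ONE prime above `ℓ` — the hypothesis of Iwasawa's 1956 theorem on the Conj-A road.

## References

* [Serre1972] J.-P. Serre, Propriétés galoisiennes des points d'ordre fini des courbes
  elliptiques, Invent. Math. 15 (1972) 259–331: §1.3 Prop. 1–2 (pp. 263–264: the characters
  `θ_d : I_t → μ_d`, `θ : I_t ≃ lim F_q^*`), §1.7 Prop. 5 (pp. 266–267: characters of `I_t`,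
  fundamental characters of level `n`), §1.8 Prop. 6–7 (p. 268: `s ∈ G` acts `σ`-semilinearly on
  `m_α/m_α⁺`; the character of `I_t` there is `χ_α`) — whence Frobenius conjugation raises the
  characters of `I_t` to the `q`-th power —, §1.9 Prop. 9 and Cor. 1–2 (pp. 269–270), §1.11
  Prop. 12 c), d) (p. 275).  (§1.8 Prop. 8, p. 269, is the statement `χ|_{μ_p} = θ_{p-1}^e`; it is
  not used here.)
* [NeukirchANT1999] J. Neukirch, *Algebraic Number Theory*, Ch. I §9 (9.4)–(9.6) (Frobenius,
  inertia, conjugate primes).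
-/

noncomputable section

open scoped Classical NumberField Pointwise
open IsDedekindDomain Field Polynomial WeierstrassCurve

namespace Literature.NumberTheory.EllipticCurves

open Literature.NumberTheory.GaloisRepresentations Rat.HeightOneSpectrum

variable (ℓ : ℕ) [Fact ℓ.Prime]

/-! ### Inertia, Frobenius and the tame Kummer character -/

section Tame

variable {𝔓 : Ideal (absIntegers (𝓞 ℚ) ℚ)}
  (hmem : ∀ x : absIntegers (𝓞 ℚ) ℚ, x ∈ 𝔓 ↔ (x : AlgebraicClosure ℚ) ∈ (placeOver ℓ).nonunits)
include hmem

/-- **Inertia fixes the roots of unity of order prime to `ℓ`**: for `s ∈ I_𝔓` and `ξ^m = 1` with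
`ℓ ∤ m`, `s ξ = ξ` (`s ξ / ξ` is an `m`-th root of unity `≡ 1 (mod 𝔓)`, hence `= 1`:
`eq_one_of_pow_eq_one_of_valuation_sub_one_lt`). [cite: Serre1972, §1.3] -/
theorem smul_eq_of_pow_eq_one_of_mem_inertia {m : ℕ} (hm : ¬ (ℓ : ℤ) ∣ (m : ℤ))
    {s : absoluteGaloisGroup ℚ} (hs : s ∈ 𝔓.inertia (absoluteGaloisGroup ℚ))
    {ξ : AlgebraicClosure ℚ} (hξ : ξ ^ m = 1) : s • ξ = ξ := by
  set v := (placeOver ℓ).valuation with hv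
  have hm0 : m ≠ 0 := by rintro rfl; exact hm (by simp)
  have hvξ : v ξ = 1 := by
    have h1 : v ξ ^ m = 1 ^ m := by rw [← map_pow, hξ, map_one, one_pow]
    exact pow_left_injective_of_ne_zero hm0 h1
  have hξ0 : ξ ≠ 0 := fun h ↦ by rw [h, map_zero] at hvξ; exact zero_ne_one hvξ
  have hξmem : ξ ∈ placeOver ℓ := (ValuationSubring.valuation_le_one_iff _ _).mp hvξ.le
  have hlt : v (s • ξ - ξ) < 1 := valuation_smul_sub_lt_one_of_mem_inertia hmem hs hξmem
  have hη : (s • ξ / ξ) ^ m = 1 := by rw [div_pow, ← smul_pow', hξ, smul_one, div_one]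
  have hη1 : v (s • ξ / ξ - 1) < 1 := by
    rw [div_sub_one hξ0, map_div₀, hvξ, div_one]; exact hlt
  have := eq_one_of_pow_eq_one_of_valuation_sub_one_lt ℓ hm hη hη1
  rwa [div_eq_one_iff_eq hξ0] at this

/-- **Conjugation by Frobenius is the `ℓ`-th power on the tame Kummer character.**  Let
`π^m = ℓ` with `ℓ ∤ m`, `ζ^m = 1`, `s ∈ I_𝔓` with `s π = ζ π`, and `φ` an arithmetic Frobenius at
`𝔓` (`φ x ≡ x^ℓ (mod 𝔓)` on `\bar ℤ`).  Then `(φ s φ⁻¹) π = ζ^ℓ π`.  (Serre §1.3 Prop. 1: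
`s(x^{1/d}) = θ_d(s) x^{1/d}`; with §1.8 Prop. 6 — `G` acts `σ`-semilinearly — conjugation by a
Frobenius lift raises `θ_d` to the `q`-th power.)  Proof: `φ⁻¹ π = η π` with `η^m = 1` fixed by
`s`, and `φ ζ = ζ^ℓ` (Mathlib `AlgHom.IsArithFrobAt.apply_of_pow_eq_one`).
[cite: Serre1972, §1.3 Prop. 1–2 (pp. 263–264) and §1.8 Prop. 6 (p. 268)] -/
theorem conj_frob_smul_kummer {v₀ : HeightOneSpectrum (𝓞 ℚ)} (hv₀ : (primesEquiv v₀ : ℕ) = ℓ)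
    (h𝔓 : 𝔓 ∈ v₀.primesAbove) {m : ℕ} (hm : ¬ (ℓ : ℤ) ∣ (m : ℤ))
    {π ζ : AlgebraicClosure ℚ} (hπ : π ^ m = ℓ) (hζ : ζ ^ m = 1)
    {s : absoluteGaloisGroup ℚ} (hs : s ∈ 𝔓.inertia (absoluteGaloisGroup ℚ)) (hsπ : s • π = ζ * π)
    {φ : absoluteGaloisGroup ℚ} (hφ : IsArithFrobAt (𝓞 ℚ) φ 𝔓) :
    (φ * s * φ⁻¹) • π = ζ ^ ℓ * π := by
  have hp : ℓ.Prime := Fact.out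
  haveI : 𝔓.IsPrime := h𝔓.1
  have hm0 : m ≠ 0 := by rintro rfl; exact hm (by simp)
  have hℓ0 : ((ℓ : ℕ) : AlgebraicClosure ℚ) ≠ 0 := Nat.cast_ne_zero.mpr hp.ne_zero
  have hπ0 : π ≠ 0 := fun h ↦ hℓ0 (by rw [← hπ, h, zero_pow hm0])
  have hℓfix : ∀ τ : absoluteGaloisGroup ℚ, τ • ((ℓ : ℕ) : AlgebraicClosure ℚ) = ℓ := fun τ ↦ by
    rw [absoluteGaloisGroup.smul_def, map_natCast]
  -- `φ ζ = ζ ^ ℓ`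
  have hq : Nat.card (𝓞 ℚ ⧸ 𝔓.under (𝓞 ℚ)) = ℓ := by
    rw [HeightOneSpectrum.card_quotient_under_eq_residueCard h𝔓,
      HeightOneSpectrum.residueCard_eq_card_quotient]
    have h : Ideal.span {(natGenerator v₀ : ℤ)} =
        v₀.asIdeal.map (Rat.IsIntegralClosure.intEquiv (𝓞 ℚ) : 𝓞 ℚ →+* ℤ) := span_natGenerator v₀
    rw [Nat.card_congr ((Ideal.quotientEquiv _ _ (Rat.IsIntegralClosure.intEquiv (𝓞 ℚ)) h).trans
      (Int.quotientSpanNatEquivZMod _)).toEquiv, Nat.card_zmod]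
    exact hv₀
  have hζint : IsIntegral (𝓞 ℚ) ζ := by
    refine IsIntegral.tower_top (R := ℤ) (A := 𝓞 ℚ) ?_
    exact ⟨Polynomial.X ^ m - 1, Polynomial.monic_X_pow_sub_C _ hm0, by simp [hζ]⟩
  set ζ' : absIntegers (𝓞 ℚ) ℚ := ⟨ζ, hζint⟩ with hζ'def
  have hζ'pow : ζ' ^ m = 1 := Subtype.ext (by rw [SubmonoidClass.coe_pow]; exact hζ)
  have hmnot : ((m : ℕ) : absIntegers (𝓞 ℚ) ℚ) ∉ 𝔓 := by
    rw [hmem, ValuationSubring.mem_nonunits_iff, not_lt]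
    have := valuation_placeOver_intCast_eq_one ℓ hm
    push_cast at this ⊢
    exact this.ge
  have hφζ : φ • ζ = ζ ^ ℓ := by
    have h := hφ.apply_of_pow_eq_one hζ'pow hmnot
    rw [hq] at h
    have h' := congrArg (fun z : absIntegers (𝓞 ℚ) ℚ ↦ (z : AlgebraicClosure ℚ)) h
    simpa only [MulSemiringAction.toAlgHom_apply, integralClosure.coe_smul, SubmonoidClass.coe_pow]
      using h'
  -- `φ⁻¹ π = η π` with `η ^ m = 1`, `s η = η`
  set η : AlgebraicClosure ℚ := φ⁻¹ • π / π with hηdef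
  have hηpow : η ^ m = 1 := by
    rw [hηdef, div_pow, ← smul_pow', hπ, hℓfix, div_self hℓ0]
  have hφπ : φ⁻¹ • π = η * π := by rw [hηdef, div_mul_cancel₀ _ hπ0]
  have hsη : s • η = η := smul_eq_of_pow_eq_one_of_mem_inertia ℓ hmem hm hs hηpow
  have hη0 : η ≠ 0 := fun h ↦ by
    rw [h, zero_pow hm0] at hηpow; exact zero_ne_one hηpow
  have hφη0 : φ • η ≠ 0 := by rw [Ne, smul_eq_zero_iff_eq]; exact hη0
  -- `π = φ (η π) = (φ η) (φ π)`
  have hφπ' : φ • π = π / φ • η := by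
    have h1 : π = φ • (η * π) := by rw [← hφπ, smul_inv_smul]
    rw [smul_mul'] at h1
    rw [eq_div_iff hφη0, mul_comm]
    exact h1.symm
  calc (φ * s * φ⁻¹) • π = φ • (s • (φ⁻¹ • π)) := by rw [mul_smul, mul_smul]
    _ = φ • (η * (ζ * π)) := by rw [hφπ, smul_mul', hsη, hsπ]
    _ = φ • η * (ζ ^ ℓ * (π / φ • η)) := by rw [smul_mul', smul_mul', hφζ, hφπ']
    _ = ζ ^ ℓ * π := by field_simp

end Tame

/-! ### An inertia element acting trivially on `E[ℓ]` acts trivially on `π` -/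

section Supersingular

variable {W : WeierstrassCurve ℚ} [W.IsGloballyMinimal] [W.IsElliptic]
  (hΔ : ¬ (ℓ : ℤ) ∣ minimalDiscriminantInt W) (hss : (ℓ : ℤ) ∣ W.frobeniusTrace ℓ) (hℓ2 : ℓ ≠ 2)
include hΔ hss hℓ2

/-- **An element of `I_𝔓` fixing `E[ℓ]` pointwise fixes every `π` with `π^{ℓ²-1} = ℓ`.**  With
`t₀ = x₀/y₀` the parameter of a point `P₀ ≠ 0` of `E[ℓ]`: `v(t₀)^{ℓ²-1} = v(ℓ) = v(π)^{ℓ²-1}`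
(`valuation_param_pow_eq`, Serre Prop. 9–10), so `w = t₀/π` is a `𝔓`-unit; `u t₀ = t₀` and
`u w ≡ w (mod 𝔓)` give `u π / π ≡ 1`, and `u π / π` is an `(ℓ²-1)`-th root of unity.
[cite: Serre1972, §1.10–1.11 (Prop. 10, Prop. 12)] -/
theorem smul_kummer_eq_of_galoisRepTorsion_eq_one {𝔓 : Ideal (absIntegers (𝓞 ℚ) ℚ)}
    (hmem : ∀ x : absIntegers (𝓞 ℚ) ℚ, x ∈ 𝔓 ↔ (x : AlgebraicClosure ℚ) ∈ (placeOver ℓ).nonunits)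
    {u : absoluteGaloisGroup ℚ} (hu : u ∈ 𝔓.inertia (absoluteGaloisGroup ℚ))
    (hρu : galoisRepTorsion W ℓ u = 1) {π : AlgebraicClosure ℚ} (hπ : π ^ (ℓ ^ 2 - 1) = ℓ) :
    u • π = π := by
  have hp : ℓ.Prime := Fact.out
  set v := (placeOver ℓ).valuation with hv
  set n := ℓ ^ 2 - 1 with hn
  have hℓ2' : 4 ≤ ℓ ^ 2 := by nlinarith [hp.two_le]
  have hn0 : n ≠ 0 := by omega
  have hnℓ : ¬ (ℓ : ℤ) ∣ (n : ℤ) := by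
    intro h
    have h1 : (ℓ : ℤ) ∣ ((ℓ ^ 2 : ℕ) : ℤ) := by push_cast; exact dvd_pow_self _ two_ne_zero
    have h2 : (ℓ : ℤ) ∣ ((ℓ ^ 2 : ℕ) : ℤ) - (n : ℤ) := dvd_sub h1 h
    have h3 : ((ℓ ^ 2 : ℕ) : ℤ) - (n : ℤ) = 1 := by rw [hn]; omega
    rw [h3] at h2
    exact hp.one_lt.ne' (by exact_mod_cast Int.eq_one_of_dvd_one (by positivity) h2)
  have hℓ0 : ((ℓ : ℕ) : AlgebraicClosure ℚ) ≠ 0 := Nat.cast_ne_zero.mpr hp.ne_zero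
  have hvℓ0 : v ℓ ≠ 0 := by rw [hv, Valuation.ne_zero_iff]; exact_mod_cast hp.ne_zero
  have hπ0 : π ≠ 0 := fun h ↦ hℓ0 (by rw [← hπ, h, zero_pow hn0])
  -- a nonzero torsion point and its parameter
  have hcard : Nat.card (geomTorsion W ℓ) = ℓ ^ 2 :=
    card_torsionPoints_eq_sq_holds W (AlgebraicClosure ℚ) (n := ℓ) hℓ0
  haveI : Finite (geomTorsion W ℓ) := Nat.finite_of_card_ne_zero (by rw [hcard]; positivity)
  haveI : Nontrivial (geomTorsion W ℓ) := Finite.one_lt_card_iff_nontrivial.mp (by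
    rw [hcard]; nlinarith [hp.two_le])
  obtain ⟨P₀, hP₀0⟩ := exists_ne (0 : geomTorsion W ℓ)
  have hP₀0' : (P₀ : W.geomPoints) ≠ 0 := fun h ↦ hP₀0 (Subtype.ext h)
  obtain ⟨x₀, y₀, h₀, hP₀xy⟩ := geomPoints.exists_eq_some (P := (P₀ : W.geomPoints)) hP₀0'
  have hP₀t : (ℓ : ℤ) • (P₀ : W.geomPoints) = 0 := (Submodule.mem_torsionBy_iff _ _).mp P₀.2
  set t₀ := x₀ / y₀ with ht₀def
  obtain ⟨-, ht₀n⟩ := valuation_param_pow_eq ℓ hΔ hss hℓ2 hP₀t hP₀xy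
  rw [← ht₀def] at ht₀n
  have ht₀0 : v t₀ ≠ 0 := by
    intro h0
    rw [h0, zero_pow hn0] at ht₀n
    exact hvℓ0 ht₀n.symm
  have ht₀ne : t₀ ≠ 0 := fun h ↦ ht₀0 (by rw [h, map_zero])
  -- `u t₀ = t₀`
  have hut₀ : u • t₀ = t₀ := by
    have hall : ∀ P : geomTorsion W ℓ, u • P = P := (galoisRepTorsion_eq_one_iff' W ℓ u).mp hρu
    have h1 : ((u • P₀ : geomTorsion W ℓ) : W.geomPoints) = (P₀ : W.geomPoints) := by rw [hall P₀]
    obtain ⟨h', hs'⟩ := exists_smul_eq_some (W := W) u hP₀xy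
    have h2 : ((u • P₀ : geomTorsion W ℓ) : W.geomPoints) = u • (P₀ : W.geomPoints) := rfl
    rw [h2, hs', hP₀xy] at h1
    obtain ⟨hx, hy⟩ := (Affine.Point.some.injEq _ _ _ _ _ _).mp h1
    rw [ht₀def, ← smul_div_eq, hx, hy]
  -- `w = t₀ / π` is a unit on which `u` acts trivially mod `𝔓`
  have hvπ : v π = v t₀ := by
    have h1 : v π ^ n = v t₀ ^ n := by rw [← map_pow, hπ, ht₀n]
    exact pow_left_injective_of_ne_zero hn0 h1
  have hvπ0 : v π ≠ 0 := hvπ ▸ ht₀0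
  set w := t₀ / π with hw
  have hvw : v w = 1 := by rw [hw, map_div₀, hvπ, div_self ht₀0]
  have hwmem : w ∈ placeOver ℓ := (ValuationSubring.valuation_le_one_iff _ _).mp hvw.le
  have hw0 : w ≠ 0 := fun h ↦ by rw [h, map_zero] at hvw; exact zero_ne_one hvw
  have huw : v (u • w - w) < 1 := valuation_smul_sub_lt_one_of_mem_inertia hmem hu hwmem
  have hvuw : v (u • w) = 1 := by
    have : u • w = w + (u • w - w) := by ring
    rw [this, Valuation.map_add_eq_of_lt_left _ (by rwa [hvw]), hvw]
  have huw0 : u • w ≠ 0 := fun h ↦ by rw [h, map_zero] at hvuw; exact zero_ne_one hvuw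
  -- `u π / π = w / u w ≡ 1`
  have ht₀w : t₀ = w * π := by rw [hw, div_mul_cancel₀ _ hπ0]
  have huπ : u • π / π = w / u • w := by
    have h1 : u • w * u • π = w * π := by rw [← smul_mul', ← ht₀w, hut₀]
    rw [div_eq_div_iff hπ0 huw0]
    linear_combination h1
  have hχpow : (u • π / π) ^ n = 1 := by
    have huℓ : u • ((ℓ : ℕ) : AlgebraicClosure ℚ) = ℓ := by
      rw [absoluteGaloisGroup.smul_def, map_natCast]
    rw [div_pow, ← smul_pow', hπ, huℓ, div_self hℓ0]
  have hχ1 : v (u • π / π - 1) < 1 := by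
    rw [huπ, div_sub_one huw0, map_div₀, hvuw, div_one, ← Valuation.map_neg, neg_sub]
    exact huw
  have hχ := eq_one_of_pow_eq_one_of_valuation_sub_one_lt ℓ hnℓ hχpow hχ1
  rwa [div_eq_one_iff_eq hπ0] at hχ

/-- **Serre 1972, Prop. 12 d), local half: an arithmetic Frobenius does not act on `E[ℓ]` through
the image of inertia — `ρ̄_{E,ℓ}(φ) ∉ ρ̄_{E,ℓ}(I_𝔓)`.**  `E/ℚ` minimal, `ℓ` odd of good
supersingular reduction, `𝔓` the prime of `\bar ℤ` of the place `placeOver ℓ` (hypothesis shape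
`hmem`), lying over the place `v₀` of `ℚ` at `ℓ`, `φ` with `φ x ≡ x^ℓ (mod 𝔓)`.  Proof: `ρ̄(I_𝔓)` is
cyclic (`isCyclic_and_card_inertia_map_of_dvd_frobeniusTrace`, with the tame Kummer input
`exists_mem_inertia_smul_eq_mul_of_pow_eq`), so `ρ̄(φ) ∈ ρ̄(I_𝔓)` would commute with `ρ̄(s₀)` for the
Kummer generator `s₀ π = ζ π` (`ζ` primitive of order `ℓ² - 1`); then `u = s₀⁻¹ φ s₀ φ⁻¹ ∈ I_𝔓` acts
trivially on `E[ℓ]`, hence on `π` (`smul_kummer_eq_of_galoisRepTorsion_eq_one`), whereas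
`u π = ζ^{ℓ-1} π` (`conj_frob_smul_kummer`) and `ζ^{ℓ-1} ≠ 1`.
[cite: Serre1972, §1.11 Prop. 12 d) (p. 275); §1.9 Prop. 9 Cor. 2 (p. 270)] -/
theorem galoisRepTorsion_not_mem_map_inertia_of_isArithFrobAt {v₀ : HeightOneSpectrum (𝓞 ℚ)}
    (hv₀ : (primesEquiv v₀ : ℕ) = ℓ) {𝔓 : Ideal (absIntegers (𝓞 ℚ) ℚ)}
    (hmem : ∀ x : absIntegers (𝓞 ℚ) ℚ, x ∈ 𝔓 ↔ (x : AlgebraicClosure ℚ) ∈ (placeOver ℓ).nonunits)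
    (h𝔓 : 𝔓 ∈ v₀.primesAbove) {φ : absoluteGaloisGroup ℚ} (hφ : IsArithFrobAt (𝓞 ℚ) φ 𝔓) :
    galoisRepTorsion W ℓ φ ∉ (𝔓.inertia (absoluteGaloisGroup ℚ)).map (galoisRepTorsion W ℓ) := by
  have hp : ℓ.Prime := Fact.out
  haveI : 𝔓.IsPrime := h𝔓.1
  set I := 𝔓.inertia (absoluteGaloisGroup ℚ) with hI
  set ρ := galoisRepTorsion W ℓ with hρ
  set n := ℓ ^ 2 - 1 with hn
  have hℓ2' : 4 ≤ ℓ ^ 2 := by nlinarith [hp.two_le]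
  have hn0 : n ≠ 0 := by omega
  have hnpos : 0 < n := Nat.pos_of_ne_zero hn0
  have hnℓ : ¬ (ℓ : ℤ) ∣ (n : ℤ) := by
    intro h
    have h1 : (ℓ : ℤ) ∣ ((ℓ ^ 2 : ℕ) : ℤ) := by push_cast; exact dvd_pow_self _ two_ne_zero
    have h2 : (ℓ : ℤ) ∣ ((ℓ ^ 2 : ℕ) : ℤ) - (n : ℤ) := dvd_sub h1 h
    have h3 : ((ℓ ^ 2 : ℕ) : ℤ) - (n : ℤ) = 1 := by rw [hn]; omega
    rw [h3] at h2
    exact hp.one_lt.ne' (by exact_mod_cast Int.eq_one_of_dvd_one (by positivity) h2)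
  -- tame Kummer input and the cyclic inertia image
  have hT : ∀ π ζ : AlgebraicClosure ℚ, π ^ (ℓ ^ 2 - 1) = ℓ → ζ ^ (ℓ ^ 2 - 1) = 1 →
      ∃ s ∈ 𝔓.inertia (absoluteGaloisGroup ℚ), s • π = ζ * π := fun π ζ hπ hζ ↦
    exists_mem_inertia_smul_eq_mul_of_pow_eq ℓ hnpos hv₀ h𝔓 hπ hζ
  obtain ⟨hcyc, -⟩ := isCyclic_and_card_inertia_map_of_dvd_frobeniusTrace ℓ hΔ hss hℓ2 hmem hT
  -- a Kummer generator `s₀ π = ζ π`, `ζ` primitive of order `n`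
  obtain ⟨π, hπ⟩ := IsAlgClosed.exists_pow_nat_eq (ℓ : AlgebraicClosure ℚ) hnpos
  haveI : NeZero ((n : ℕ) : AlgebraicClosure ℚ) := ⟨Nat.cast_ne_zero.mpr hn0⟩
  obtain ⟨ζ, hζ⟩ := IsAlgClosed.exists_root (cyclotomic n (AlgebraicClosure ℚ))
    (degree_cyclotomic_pos n _ hnpos).ne'
  have hζprim : IsPrimitiveRoot ζ n := isRoot_cyclotomic_iff.mp hζ
  obtain ⟨s₀, hs₀I, hs₀⟩ := hT π ζ hπ hζprim.pow_eq_one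
  have hℓ0 : ((ℓ : ℕ) : AlgebraicClosure ℚ) ≠ 0 := Nat.cast_ne_zero.mpr hp.ne_zero
  have hπ0 : π ≠ 0 := fun h ↦ hℓ0 (by rw [← hπ, h, zero_pow hn0])
  -- suppose `ρ φ ∈ ρ(I)`; then `ρ φ` commutes with `ρ s₀`
  intro hφmem
  have hs₀mem : ρ s₀ ∈ I.map ρ := Subgroup.mem_map_of_mem ρ hs₀I
  have hcomm : ρ φ * ρ s₀ = ρ s₀ * ρ φ := by
    haveI := hcyc
    letI := IsCyclic.commGroup (α := I.map ρ)
    have := mul_comm (⟨ρ φ, hφmem⟩ : I.map ρ) ⟨ρ s₀, hs₀mem⟩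
    exact congrArg Subtype.val this
  -- `u = s₀⁻¹ (φ s₀ φ⁻¹) ∈ I` acts trivially on `E[ℓ]`
  have hφ𝔓 : φ • 𝔓 = 𝔓 := hφ.mem_stabilizer
  have htI : φ * s₀ * φ⁻¹ ∈ I := by
    intro x
    have hx : s₀ • (φ⁻¹ • x) - φ⁻¹ • x ∈ 𝔓 := hs₀I (φ⁻¹ • x)
    have : φ • (s₀ • (φ⁻¹ • x) - φ⁻¹ • x) ∈ φ • 𝔓 := Ideal.smul_mem_pointwise_smul _ _ _ hx
    rw [hφ𝔓, smul_sub, smul_inv_smul] at this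
    simpa [mul_smul] using this
  have huI : s₀⁻¹ * (φ * s₀ * φ⁻¹) ∈ I := I.mul_mem (I.inv_mem hs₀I) htI
  have hρu : ρ (s₀⁻¹ * (φ * s₀ * φ⁻¹)) = 1 := by
    rw [map_mul, map_mul, map_mul, map_inv, map_inv, hcomm, mul_inv_cancel_right, inv_mul_cancel]
  have huπ : (s₀⁻¹ * (φ * s₀ * φ⁻¹)) • π = π :=
    smul_kummer_eq_of_galoisRepTorsion_eq_one ℓ hΔ hss hℓ2 hmem huI hρu hπ
  -- but `u π = ζ^{ℓ-1} π`
  have hts : (φ * s₀ * φ⁻¹) • π = ζ ^ ℓ * π :=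
    conj_frob_smul_kummer ℓ hmem hv₀ h𝔓 hnℓ hπ hζprim.pow_eq_one hs₀I hs₀ hφ
  have hs₀invI : s₀⁻¹ ∈ I := I.inv_mem hs₀I
  have hs₀ζ : s₀⁻¹ • ζ = ζ := smul_eq_of_pow_eq_one_of_mem_inertia ℓ hmem hnℓ hs₀invI hζprim.pow_eq_one
  have hζ0 : ζ ≠ 0 := hζprim.ne_zero hn0
  have hs₀π : s₀⁻¹ • π = ζ⁻¹ * π := by
    have h1 : π = s₀⁻¹ • (ζ * π) := by rw [← hs₀, inv_smul_smul]
    rw [smul_mul', hs₀ζ] at h1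
    rw [eq_inv_mul_iff_mul_eq₀ hζ0]
    exact h1.symm
  have huπ' : (s₀⁻¹ * (φ * s₀ * φ⁻¹)) • π = ζ ^ (ℓ - 1) * π := by
    have hζpow : ζ ^ ℓ = ζ ^ (ℓ - 1) * ζ := by
      rw [← pow_succ, Nat.sub_add_cancel hp.one_lt.le]
    have hs₀ζℓ : s₀⁻¹ • ζ ^ ℓ = ζ ^ ℓ := by rw [smul_pow', hs₀ζ]
    rw [mul_smul, hts, smul_mul', hs₀ζℓ, hs₀π, hζpow]
    field_simp
  -- so `ζ^{ℓ-1} = 1`, i.e. `n ∣ ℓ - 1`: impossible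
  rw [huπ'] at huπ
  have hζ1 : ζ ^ (ℓ - 1) = 1 := by
    have := mul_right_cancel₀ hπ0 (huπ.trans (one_mul π).symm)
    exact this
  have hdvd : n ∣ ℓ - 1 := hζprim.dvd_of_pow_eq_one _ hζ1
  have hlt : ℓ - 1 < n := by
    rw [hn]
    have : ℓ - 1 < ℓ ^ 2 - 1 := by
      have h1 : ℓ < ℓ ^ 2 := by nlinarith [hp.two_le]
      omega
    exact this
  have hpos : 0 < ℓ - 1 := by have := hp.two_le; omega
  exact absurd (Nat.le_of_dvd hpos hdvd) (not_le.mpr hlt)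

/-- **Packaged form.**  At an odd prime `ℓ` of good supersingular reduction of the minimal curve
`E/ℚ`, above the place `v₀ ∣ ℓ` of `ℚ` there is a prime `𝔓` of `\bar ℤ` and an element `φ` of its
decomposition group `D_𝔓 = Stab(𝔓)` whose image `ρ̄_{E,ℓ}(φ)` lies OUTSIDE the image
`ρ̄_{E,ℓ}(I_𝔓)` of inertia, the latter being cyclic of order `ℓ² - 1`; hence
`ρ̄(I_𝔓) < ρ̄(D_𝔓)` and `#ρ̄(D_𝔓) > ℓ² - 1` (Serre: `ρ̄(D_𝔓) = N(C)`, order `2(ℓ² - 1)`; the residue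
degree of `ℚ(E[ℓ])` at `ℓ` is `2`). [cite: Serre1972, §1.11 Prop. 12 c), d) (p. 275)] -/
theorem exists_mem_stabilizer_galoisRepTorsion_not_mem_map_inertia {v₀ : HeightOneSpectrum (𝓞 ℚ)}
    (hvℓ : (primesEquiv v₀ : ℕ) = ℓ) :
    ∃ 𝔓 ∈ v₀.primesAbove, ∃ φ ∈ MulAction.stabilizer (absoluteGaloisGroup ℚ) 𝔓,
      galoisRepTorsion W ℓ φ ∉ (𝔓.inertia (absoluteGaloisGroup ℚ)).map (galoisRepTorsion W ℓ) ∧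
      IsCyclic ((𝔓.inertia (absoluteGaloisGroup ℚ)).map (galoisRepTorsion W ℓ)) ∧
      Nat.card ((𝔓.inertia (absoluteGaloisGroup ℚ)).map (galoisRepTorsion W ℓ)) = ℓ ^ 2 - 1 := by
  have hp : ℓ.Prime := Fact.out
  obtain ⟨𝔓, hmem, h𝔓⟩ := exists_ideal_placeOver ℓ hvℓ
  haveI : 𝔓.IsPrime := h𝔓.1
  obtain ⟨φ, hφ⟩ := HeightOneSpectrum.exists_isArithFrobAt_of_mem_primesAbove_holds (v := v₀) h𝔓
  have hnpos : 0 < ℓ ^ 2 - 1 := Nat.sub_pos_of_lt (Nat.one_lt_pow two_ne_zero hp.one_lt)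
  have hT : ∀ π ζ : AlgebraicClosure ℚ, π ^ (ℓ ^ 2 - 1) = ℓ → ζ ^ (ℓ ^ 2 - 1) = 1 →
      ∃ s ∈ 𝔓.inertia (absoluteGaloisGroup ℚ), s • π = ζ * π := fun π ζ hπ hζ ↦
    exists_mem_inertia_smul_eq_mul_of_pow_eq ℓ hnpos hvℓ h𝔓 hπ hζ
  obtain ⟨hcyc, hcard⟩ := isCyclic_and_card_inertia_map_of_dvd_frobeniusTrace ℓ hΔ hss hℓ2 hmem hT
  exact ⟨𝔓, h𝔓, φ, hφ.mem_stabilizer,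
    galoisRepTorsion_not_mem_map_inertia_of_isArithFrobAt ℓ hΔ hss hℓ2 hvℓ hmem h𝔓 hφ, hcyc, hcard⟩

end Supersingular

end Literature.NumberTheory.EllipticCurves

end
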